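import Summits.ResolutionOfSingularities.ResolutionOfSingularities.Theorems.FrobeniusLadderFInjectiveMacaulayficationStalkChartIso
import HarnessLib

/-!
# Stalks of the affine blowing up are local rings of the charts, with the chart point recorded

Support file for crux stmt-ResolutionOfSingularities-15315
(`FrobeniusLadder.FInjectiveMacaulayfication`, line `Sketch`, lead seat c6, cycle 7):
stub `stub_stalkChartIsoPoint`.

For a commutative ring `R` and generators `x = (x₁, …, x_r)` of the ideal `I = (x₁, …, x_r)`, the
blowing up `Bl_I(Spec R) = affineBlowup I = Proj R[It]` is covered by the charts
`D₊(xᵢt) = Spec (R[It])_{(xᵢt)}` at the non-zero generators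
(`StalkChartIso.exists_mem_basicOpen_reesT`; Stacks Project, Tag 0804: the affine blowup
algebras cover the blowing up). The landed `StalkChartIso.stub_stalkChartIso` produces, for every
point `y`, a chart index `i` with `xᵢ ≠ 0`, a prime `q` of the chart ring
`A = (R[It])_{(xᵢt)}` and a ring isomorphism `𝒪_{Bl, y} ≃+* A_q`, but does not export the
equation `Proj.awayι … q = y` identifying `q` as THE point of the chart lying under `y`. The
tower argument of the crux needs this equation (to tell the unique bad point of a chart from the
other points), so we re-prove the statement with the point equation kept:

* `stub_stalkChartIsoPoint` — the registered stub: every point `y` of `affineBlowup I` is the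
  image `Proj.awayι … q` of a prime `q` of the chart ring of some non-zero generator `xᵢ`, and
  `𝒪_{Bl, y} ≃+* A_q` (the stalk map of the open immersion `Proj.awayι`, whose range is `D₊(xᵢt)`
  by `Proj.opensRange_awayι`, composed with `Spec.stalkIso`).

References: The Stacks Project, Tag 0804 (Lemma 31.32.2: the affine blowup algebras `R[I/a]`
cover the blowing up); R. Hartshorne, *Algebraic Geometry*, Prop. II.2.5 (charts of `Proj`) and
Prop. II.2.2 (stalks of `Spec`); the rest is folklore.
-/

-- single-problem summit: the doubled namespace component is forced
set_option linter.dupNamespace false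

noncomputable section

namespace Summit.ResolutionOfSingularities.ResolutionOfSingularities.Theorems.FInjectiveMacaulayfication.StalkChartIsoPoint

open AlgebraicGeometry CategoryTheory Literature.AlgebraicGeometry.Resolution

/-- **Stalks of the blowing up are local rings of the charts, with the chart point recorded**
(registered stub `stub_stalkChartIsoPoint`): every point `y` of `Bl_I(Spec R) = affineBlowup I`,
`I = (x₁, …, x_r)`, is the image under the chart map
`Proj.awayι : Spec (R[It])_{(xᵢt)} ⟶ Proj R[It]` of a prime `q` of the chart ring of some
non-zero generator `xᵢ`, and its stalk is ring-isomorphic to the localization of the chart ring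
at `q`: the open immersion `Proj.awayι` has range `D₊(xᵢt)`, its stalk maps are isomorphisms, and
the stalk of `Spec A` at `q` is `A_q`. [cite: StacksProject, Tag 0804] -/
theorem stub_stalkChartIsoPoint : ∀ (R : Type) [CommRing R] (r : ℕ) (x : Fin r → R)
    (y : ↥(affineBlowup (Ideal.span (Set.range x)))),
    ∃ (i : Fin r) (q : PrimeSpectrum (HomogeneousLocalization.Away (reesGrading (Ideal.span (Set.range x)))
        (reesT (x i) (Ideal.subset_span (Set.mem_range_self i))))),
      x i ≠ 0 ∧
      (Proj.awayι (reesGrading (Ideal.span (Set.range x))) (reesT (x i) (Ideal.subset_span (Set.mem_range_self i)))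
          (reesT_mem (x i) (Ideal.subset_span (Set.mem_range_self i))) Nat.one_pos).base q = y ∧
      Nonempty (((affineBlowup (Ideal.span (Set.range x))).presheaf.stalk y) ≃+*
        Localization.AtPrime q.asIdeal) := by
  intro R _ r x y
  obtain ⟨i, hxi, hi⟩ := StalkChartIso.exists_mem_basicOpen_reesT x y
  rw [← Proj.opensRange_awayι (reesGrading (Ideal.span (Set.range x)))
    (reesT (x i) (Ideal.subset_span (Set.mem_range_self i)))
    (reesT_mem (x i) (Ideal.subset_span (Set.mem_range_self i))) Nat.one_pos] at hi
  obtain ⟨q, rfl⟩ := Scheme.Hom.mem_opensRange.mp hi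
  exact ⟨i, q, hxi, rfl, ⟨((asIso ((Proj.awayι (reesGrading (Ideal.span (Set.range x)))
    (reesT (x i) (Ideal.subset_span (Set.mem_range_self i)))
    (reesT_mem (x i) (Ideal.subset_span (Set.mem_range_self i))) Nat.one_pos).stalkMap q)
      ).commRingCatIsoToRingEquiv).trans (Spec.stalkIso (.of _) q).commRingCatIsoToRingEquiv⟩⟩

end Summit.ResolutionOfSingularities.ResolutionOfSingularities.Theorems.FInjectiveMacaulayfication.StalkChartIsoPoint
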